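import Summits.ResolutionOfSingularities.ResolutionOfSingularities.Theorems.EquisingularLiftEquisingularLiftNatJunctionTransversal
import HarnessLib

/-!
# SUB-LIFT device: the trace of a Δ-centre on an `O`-model of a sub-curve is a principal Cartier divisor

[OURS · L1 W4.5(b)] Helper for the research stub `stub_elnat_three` (reshape v3: `stub_elnat_three_isolated`,
the carrier game) of the crux `EquisingularLiftNat` (stmt-ResolutionOfSingularities-20038; route
`EquisingularLift`, chain w45b, CRUX-PLAN v3 §1.7 (b) «SUB-LIFT device»). NOT a statement of any
manuscript; AI-written kernel lemma of the cell `res-hironaka` (weaker than expert review). Kernel form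
of the plan's 6-line hand computation: «after a Δ-step on a reducible `Z = Z″ ∪ Z‴ ⊂ Ẽ` … `C := St_{C_Δ}(D′)`
with `D′ ⊂ Ẽ` any regular `O`-model of `Z″` alone (plane curve ⇒ `V(g̃″ + ϖG′)`); `D′ ∩ C_Δ =
V(ϖ·(G − G′·g̃‴))|_{D′}` is a principal Cartier divisor on `D′`, so `C ≅ D′` is regular».

**Setting** (any commutative ring `A` — in the application `A = O[x, y]`, an affine chart of the
`O`-smooth carrier `Ẽ`, `ϖ` the uniformizer of the DVR `O`): `g₂, g₃, G, G' ∈ A`; the Δ-centre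
`C_Δ = V(g₂ g₃ + ϖ G)` (a lift of the reducible plane curve `Z = V(ḡ₂ ḡ₃)` merged by `ϖ G`), the
sub-curve model `D′ = V(g₂ + ϖ G')` (an `O`-model of `Z″ = V(ḡ₂)` alone), `𝒪_{D′} = A/(g₂ + ϖG')`.

**Proved here:**
* `subLift_trace_generator` — in `𝒪_{D′}`: `(g₂g₃ + ϖG)‾ = (ϖ (G − G' g₃))‾`;
* `subLift_trace_eq_span` — the trace ideal `I_{C_Δ} · 𝒪_{D′}` is the principal ideal `(ϖ(G − G'g₃))‾`;
* `subLift_trace_generator_mem_nonZeroDivisors` — it is generated by a non-zero-divisor as soon as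
  `ϖ̄` and `(G − G'g₃)‾` are non-zero-divisors of `𝒪_{D′}` (`D′` flat over `O` and `G − G'g₃` not
  vanishing on a component of `D′`): the trace is an effective CARTIER divisor;
* `blowupAlgebra_span_singleton_equiv`, `basicOpen_reesT_eq_top_of_span_singleton` — general: for a
  principal ideal `I = (c)` with `c` a non-zero-divisor of a ring `S`, the one chart `D₊(ct)` is all of
  `Bl_I(Spec S)` and its ring `S[I/c]` is `S` itself (so `Bl_{(c)} Spec S ≅ Spec S`); hence
  `St_{C_Δ}(D′) = Bl_{I_{C_Δ}𝒪_{D′}}(D′) ≅ D′` — the strict transform of the sub-curve model under the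
  Δ-step is the model itself (regular if `D′` is).

What is NOT here: the identification of the special fibre of `St_{C_Δ}(D′)` inside the exceptional
divisor with the carrier-direction section `Γ″ = ℙ(N_{Z/Ẽ_k})|_{Z″}` (the «`C_k = Γ″` exactly» clause),
which is a statement about the ambient blow-up.
References: folklore; The Stacks Project, Tags 0804, 07Z3.
-/

-- single-problem summit: the doubled namespace component `ResolutionOfSingularities` is forced
set_option linter.dupNamespace false

noncomputable section

namespace Summit.ResolutionOfSingularities.ResolutionOfSingularities.Theorems.EquisingularLift.Junction

universe u

open Literature.AlgebraicGeometry.Resolution AlgebraicGeometry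

variable {A : Type u} [CommRing A]

/-- **The SUB-LIFT identity**: modulo `g₂ + ϖG'`, `g₂g₃ + ϖG ≡ ϖ(G − G'g₃)`. [folklore] -/
theorem subLift_trace_generator (g₂ g₃ G G' ϖ : A) :
    Ideal.Quotient.mk (Ideal.span {g₂ + ϖ * G'}) (g₂ * g₃ + ϖ * G) =
      Ideal.Quotient.mk (Ideal.span {g₂ + ϖ * G'}) (ϖ * (G - G' * g₃)) := by
  rw [Ideal.Quotient.mk_eq_mk_iff_sub_mem, Ideal.mem_span_singleton']
  exact ⟨g₃, by ring⟩

/-- **The trace of the Δ-centre on the sub-curve model is principal**: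
`I_{C_Δ}·𝒪_{D′} = ((g₂g₃ + ϖG)‾) = ((ϖ(G − G'g₃))‾)`. [folklore] -/
theorem subLift_trace_eq_span (g₂ g₃ G G' ϖ : A) :
    (Ideal.span {g₂ * g₃ + ϖ * G}).map (Ideal.Quotient.mk (Ideal.span {g₂ + ϖ * G'})) =
      Ideal.span {Ideal.Quotient.mk (Ideal.span {g₂ + ϖ * G'}) (ϖ * (G - G' * g₃))} := by
  rw [Ideal.map_span, Set.image_singleton, subLift_trace_generator]

/-- The generator is a non-zero-divisor of `𝒪_{D′}` when `ϖ̄` and `(G − G'g₃)‾` are (e.g. `D′` flat over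
the DVR and `G − G'g₃` non-zero on every component of the integral `D′`): the trace is an effective
Cartier divisor. [folklore] -/
theorem subLift_trace_generator_mem_nonZeroDivisors (g₂ g₃ G G' ϖ : A)
    (hϖ : Ideal.Quotient.mk (Ideal.span {g₂ + ϖ * G'}) ϖ ∈
      nonZeroDivisors (A ⧸ Ideal.span {g₂ + ϖ * G'}))
    (hG : Ideal.Quotient.mk (Ideal.span {g₂ + ϖ * G'}) (G - G' * g₃) ∈
      nonZeroDivisors (A ⧸ Ideal.span {g₂ + ϖ * G'})) :
    Ideal.Quotient.mk (Ideal.span {g₂ + ϖ * G'}) (ϖ * (G - G' * g₃)) ∈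
      nonZeroDivisors (A ⧸ Ideal.span {g₂ + ϖ * G'}) := by
  rw [map_mul]
  exact mul_mem hϖ hG

/-! ## Blowing up a principal ideal generated by a non-zero-divisor changes nothing -/

section Principal

variable {S : Type u} [CommRing S]

/-- For `I = (c)` with `c` a non-zero-divisor: `S[I/c] = S·1 ⊆ S[1/c]` (the case `b = 0` of
`blowupAlgebra_eq_bot_of_mul_eq_zero`) and `S → S[I/c]` is an isomorphism (its kernel, the `c`-power
torsion, vanishes). [folklore] -/
theorem blowupAlgebra_span_singleton_equiv (c : S) (hc : c ∈ nonZeroDivisors S) {I : Ideal S}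
    (hI : I = Ideal.span {c}) :
    ∃ e : S ≃+* blowupAlgebra I c, ∀ s : S, e s = algebraMap S (blowupAlgebra I c) s := by
  have hI' : I = Ideal.span {c, 0} := by rw [hI, Ideal.span_pair_zero]
  obtain ⟨e₁, he₁⟩ := exists_ringEquiv_blowupAlgebra_of_eq_bot c
    (blowupAlgebra_eq_bot_of_mul_eq_zero (mul_zero c) hI')
  have hker : RingHom.ker (algebraMap S (Localization.Away c)) = ⊥ := by
    refine ker_algebraMap_away_eq c ⊥ fun x => ?_
    rw [Ideal.mem_bot]
    constructor
    · rintro rfl; exact ⟨0, by rw [mul_zero]⟩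
    · rintro ⟨n, hn⟩
      exact (mem_nonZeroDivisors_iff_right.mp (pow_mem hc n)) x (by rwa [mul_comm] at hn)
  let e₀ : S ≃+* S ⧸ RingHom.ker (algebraMap S (Localization.Away c)) :=
    ((Ideal.quotEquivOfEq hker).trans (RingEquiv.quotientBot S)).symm
  refine ⟨e₀.trans e₁, fun s => ?_⟩
  rw [RingEquiv.trans_apply, ← he₁]
  congr 1

/-- For `I = (c)`: the single chart `D₊(ct)` is the whole of `Bl_I(Spec S)`. [folklore] -/
theorem basicOpen_reesT_eq_top_of_span_singleton (c : S) {I : Ideal S} (hI : I = Ideal.span {c})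
    (hc : c ∈ I) :
    Proj.basicOpen (reesGrading I) (reesT c hc) = ⊤ := by
  have hI' : I = Ideal.span {c, 0} := by rw [hI, Ideal.span_pair_zero]
  have h0 : (0 : S) ∈ I := I.zero_mem
  have h := basicOpen_sup_basicOpen_eq_top_of_span_pair hI' hc h0
  have hz : reesT (I := I) 0 h0 = 0 := Subtype.ext (by rw [coe_reesT, map_zero]; rfl)
  rwa [hz, Proj.basicOpen_zero, sup_bot_eq] at h

end Principal

end Summit.ResolutionOfSingularities.ResolutionOfSingularities.Theorems.EquisingularLift.Junction

end
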